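import Summits.QuantumFields.YangMills.Theorems.SmallFieldWideningWideningOfTiltAndMassSchema

/-!
# Route `SmallFieldWidening` — THE WIDENING'S MINIMAL SMALL-FIELD INPUT: CAUCHY CONDITIONAL EXPECTATIONS GIVEN UV-SMALL
# HISTORY (support file for item `WideningOfTiltAndMass`, stmt-QuantumFields-22885; seat `ym-line-sfw-p1` gen 8)

WHAT THE LANDED WIDENING REALLY CONSUMES.  The item (PROVED, `smallFieldWidening_wideningOfTiltAndMass_proof`) and its by-name
patterns (gen 6 `WideningOfTiltAndMass.hasContinuumLimit_of_refine_unitTilt_uniformMass`, gen 7 TV layer) take crux r2 in KING'S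
SHAPE: consecutive runs' unit push-forwards restricted to the all-heights small-field events are TILTS MODULO CONSTANTS with
SUP-NORM log-density radii `r_K`, `Σ r_K < ∞` (`UnitTiltAt … 0`).  r2's own why-it-might-fail prices exactly that norm («SUP norm
of the log-density difference, uniform over torus zero-modes — L¹ agreement would not give IsTilt»).  But the Moore–Osgood device
underneath uses the tilt ONLY to make ONE real sequence Cauchy: the normalised good expectations `⨍ W d(A_K)_*(Gibbs_K|good_K)` —
the CONDITIONAL EXPECTATIONS of the bounded unit-field observable `W` GIVEN UV-small history.  Nothing else sees the tilt.
§1 Pure measure theory: one law `P = μ + μ'`, `μ'(univ) ≤ δ` ⇒ `|∫ W dP − ⨍ W dμ| ≤ 2δ` (Mathlib's `⨍`; no `δ < 1` needed); hence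
   «Cauchy conditional expectations + `K`-uniform bad mass ⇒ within `2δ` of a Cauchy sequence».  Two certified SUFFICIENT
   conditions for Cauchy averages: a chain of tilts with summable radii (NO mass hypothesis; the degenerate constant `C = 0`
   propagates up the chain) and summable increments of the normalised laws (the total-variation / `L¹` typing).
§2 One family, every `G`, every measurable `ℰ`, any measurable windows `E_K`, steps `K < K₀` excised: Cauchy conditional unit-law
   expectations given `E_K` + Gibbs masses of `E_Kᶜ` `≤ δ` ⇒ unit-law expectations within `2δ` of a Cauchy sequence.
§3 THE PATTERN (every `G`, `ℰ`): Cauchy conditional expectations of the ORIGINAL loop products `coarseObs` (the literal minimum,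
   `∀ ε ∃ depth` form) or of every bounded measurable unit-field observable (`δ n → 0` form), at the refinement depths, + `K`-uniform
   window masses ⇒ `HasContinuumLimit (F.scheme ℰ γ)`; on `SU(N)` all four conjuncts of `ContinuumYM3Torus`.
§4 Leaf level (`SU(2)`/`ℰp`): `ym3TorusSU2_of_smallFieldCauchy` — r2 RE-READ AS «below `γ₁(L, b₀, p₀) > 0` the conditional
   expectations of every bounded measurable unit-field observable GIVEN ALL-HEIGHTS UV-SMALL HISTORY form a Cauchy sequence in
   `K`» + r3 `LargeFieldMassRefinementTail` AS FILED ⇒ the rung-R3 leaf `YM3TorusSU2`; the windowed / floored / excised form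
   `ym3TorusSU2_of_windowCondCauchy`; and the TOTAL-VARIATION typing `ym3TorusSU2_of_summableCondIncrements`.
§5 CERTIFICATES OF STRENGTH: `UnitTiltAt F γ b₀ p₀ 0 ⇒` the Cauchy property, hence `AllHeightsSmallTilt ⇒` the hypothesis of §4
   and r2 → r3 → leaf factors through §4 (`ym3TorusSU2_of_cruxes_via_smallFieldCauchy`).  So the new hypothesis sits BETWEEN the
   filed r2 and what the assembly needs, and already follows from an `L¹`/total-variation comparison of consecutive constrained
   unit laws: the sup-norm, zero-mode-uniform log-density control is a property of King's METHOD ([King1986] (3.9)), not a demand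
   of this route's architecture (D-0014 reading for the planner-of-record; no item text is changed here).
WHAT THIS IS NOT: no estimate on any Gibbs measure, no proof of r2 or r3 (both OPEN), no d = 4, no mass gap, no Clay — the leaf
is the rung-R3 RECORD label; everything here is CONDITIONAL plumbing (measure theory + real sequences over tree objects).
Sources: [King1986] Thm 3.4, (3.9)–(3.13) p. 656; [Balaban1985UV3] (7) p. 257; the iterated-limit step is folklore (Moore–Osgood).
-/

noncomputable section

open MeasureTheory Filter Topology
open scoped ENNReal
open Literature.MathematicalPhysics.QuantumFieldTheory.Balaban1983to89
open Literature.MathematicalPhysics.QuantumFieldTheory.Balaban1983to89.Missing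
open Literature.MathematicalPhysics.QuantumFieldTheory.Balaban1983to89.T3ContinuumYM3Torus
open Literature.MathematicalPhysics.QuantumFieldTheory.Balaban1983to89.T3ThresholdRemoval
open Literature.MathematicalPhysics.QuantumFieldTheory.Balaban1983to89.T3UnitLawDensityEML (ℰp measurableE_ℰp)
open Literature.MathematicalPhysics.QuantumFieldTheory.Balaban1983to89.T3UnitScaleTilt
open Summit.QuantumFields.YangMills.Theorems.LargeFieldMassRefinementTailProfileMono (largeFieldMassRefinementTail_beyond)
open Summit.QuantumFields.YangMills.Theorems.WideningOfTiltAndMass (exists_depth_le refine_coupling_pos)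

namespace Summit.QuantumFields.YangMills.Theorems.WideningSmallFieldCauchy

/-! ## §1 Pure measure theory: one law, Cauchy averages, two sufficient conditions -/

section Abstract

variable {X : Type*} [MeasurableSpace X]

/-- **BAD PART PLUS NORMALISATION DEFECT, ONE LAW**: a probability law `P = μ + μ'` with bad mass `μ'(univ) ≤ δ`; then for every
measurable `|W| ≤ 1`, `∫ W dP` is within `2δ` of the AVERAGE `⨍ W dμ` over the good part (the conditional expectation given the
good event; if `μ = 0` the average is `0` by Mathlib's convention and the bound reads `|∫ W dμ'| ≤ δ ≤ 2δ`). [folklore] -/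
theorem abs_integral_sub_average_le {P μ μ' : Measure X} [IsProbabilityMeasure P] (hP : P = μ + μ') {δ : ℝ}
    (hδ : μ'.real Set.univ ≤ δ) {W : X → ℝ} (hWm : Measurable W) (hW : ∀ x, |W x| ≤ 1) :
    |(∫ x, W x ∂P) - ⨍ x, W x ∂μ| ≤ 2 * δ := by
  have hle : μ ≤ P := by rw [hP]; exact Measure.le_add_right le_rfl
  have hle' : μ' ≤ P := by rw [hP]; exact Measure.le_add_left le_rfl
  haveI : IsFiniteMeasure μ := isFiniteMeasure_of_le P hle
  haveI : IsFiniteMeasure μ' := isFiniteMeasure_of_le P hle'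
  have hmass : μ.real Set.univ + μ'.real Set.univ = 1 := by
    rw [← measureReal_add_apply (μ₁ := μ) (μ₂ := μ') (s := Set.univ) (measure_ne_top _ _)
      (measure_ne_top _ _), ← hP, probReal_univ]
  have hbd : ∀ (κ : Measure X) [IsFiniteMeasure κ], |∫ x, W x ∂κ| ≤ κ.real Set.univ := fun κ _ => by
    have h1 := norm_integral_le_of_norm_le_const (μ := κ) (C := 1) (f := W)
      (ae_of_all _ fun x => by rw [Real.norm_eq_abs]; exact hW x)
    rwa [Real.norm_eq_abs, one_mul] at h1
  have hint : ∀ (κ : Measure X) [IsFiniteMeasure κ], Integrable W κ := fun κ _ =>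
    (integrable_const (1 : ℝ)).mono' hWm.aestronglyMeasurable
      (ae_of_all _ fun x => by rw [Real.norm_eq_abs]; exact hW x)
  have hδ0 : 0 ≤ δ := measureReal_nonneg.trans hδ
  by_cases hZ : μ.real Set.univ = 0
  · -- the good part vanishes: the average is `0` and `P = μ'`
    have hμ0 : μ = 0 := by
      rw [measureReal_def] at hZ
      exact Measure.measure_univ_eq_zero.mp
        (((ENNReal.toReal_eq_zero_iff _).mp hZ).resolve_right (measure_ne_top μ _))
    rw [hμ0, average_zero_measure, sub_zero, hP, hμ0, zero_add]
    exact ((hbd μ').trans hδ).trans (by linarith)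
  · have hZpos : 0 < μ.real Set.univ := lt_of_le_of_ne measureReal_nonneg (Ne.symm hZ)
    rw [average_eq, smul_eq_mul, hP, integral_add_measure (hint _) (hint _)]
    exact abs_add_sub_inv_mul_le hZpos
      (by linarith [measureReal_nonneg (μ := μ') (s := Set.univ)])
      (by linarith) (hbd μ) ((hbd μ').trans hδ)

/-- **APPROXIMATELY CAUCHY EXPECTATIONS FROM CAUCHY CONDITIONAL EXPECTATIONS** (steps `K < K₀` excised): probability laws
`P_K = μ_K + μ'_K` with bad masses `μ'_K(univ) ≤ δ` (`K ≥ K₀`); if the AVERAGES `K ↦ ⨍ W dμ_{K+K₀}` of a measurable `|W| ≤ 1` form a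
Cauchy sequence, the expectations `K ↦ ∫ W dP_{K+K₀}` are within `2δ` of a Cauchy sequence — the whole use the landed widening makes
of its tilt hypothesis. [cite: King1986, Thm 3.4 (3.9)-(3.13) p.656] -/
theorem exists_cauchySeq_near_integral_of_cauchySeq_average (P μ μ' : ℕ → Measure X) (K₀ : ℕ)
    (hPp : ∀ K, IsProbabilityMeasure (P K)) (hP : ∀ K, K₀ ≤ K → P K = μ K + μ' K) {δ : ℝ}
    (hδ : ∀ K, K₀ ≤ K → (μ' K).real Set.univ ≤ δ) {W : X → ℝ} (hWm : Measurable W) (hW : ∀ x, |W x| ≤ 1)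
    (hC : CauchySeq fun K => ⨍ x, W x ∂μ (K + K₀)) :
    ∃ b : ℕ → ℝ, CauchySeq b ∧ ∀ K, |(∫ x, W x ∂P (K + K₀)) - b K| ≤ 2 * δ :=
  ⟨fun K => ⨍ x, W x ∂μ (K + K₀), hC, fun K =>
    haveI := hPp (K + K₀)
    abs_integral_sub_average_le (hP (K + K₀) (Nat.le_add_left K₀ K)) (hδ (K + K₀) (Nat.le_add_left K₀ K)) hWm hW⟩

/-- A tilt (modulo a constant) of the zero measure is the zero measure (`ν = (C·e^{h})·0`). [cite: King1986, Thm 3.4 (3.9) p.656] -/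
theorem eq_zero_of_isTilt_zero {ν : Measure X} {r : ℝ} (h : IsTilt (0 : Measure X) ν r) : ν = 0 := by
  obtain ⟨-, g, C, -, -, -, hν⟩ := h; rw [hν, withDensity_zero_left]
/-- **SUFFICIENT CONDITION 1 — A CHAIN OF TILTS WITH SUMMABLE RADII ⇒ CAUCHY AVERAGES, NO mass hypothesis**: finite measures `μ_K`,
`μ_{K+1}` a tilt modulo a constant of `μ_K` of radius `r_K` (`K ≥ K₀`), `Σ r_K < ∞` ⇒ the averages `K ↦ ⨍ W dμ_{K+K₀}` of every
measurable `|W| ≤ 1` form a Cauchy sequence: either no `μ_K` vanishes (consecutive averages differ by `≤ 8 r_K`, the landed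
`abs_integral_normalize_sub_le_of_isTilt`) or one does and then all later ones do (`C = 0` propagates). [cite: King1986, Thm 3.4 (3.9)-(3.10) p.656] -/
theorem cauchySeq_average_of_isTilt (μ : ℕ → Measure X) [hfin : ∀ K, IsFiniteMeasure (μ K)] (K₀ : ℕ)
    {r : ℕ → ℝ} (hr : Summable r) (ht : ∀ K, K₀ ≤ K → IsTilt (μ K) (μ (K + 1)) (r K))
    {W : X → ℝ} (hWm : Measurable W) (hW : ∀ x, |W x| ≤ 1) :
    CauchySeq fun K => ⨍ x, W x ∂μ (K + K₀) := by
  by_cases hz : ∃ K, K₀ ≤ K ∧ μ K = 0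
  · obtain ⟨K₁, hK₁, h0⟩ := hz
    have hzero : ∀ K, K₁ ≤ K → μ K = 0 := by
      intro K hK
      induction K, hK using Nat.le_induction with
      | base => exact h0
      | succ K hK ih =>
        have htK := ht K (hK₁.trans hK)
        rw [ih] at htK
        exact eq_zero_of_isTilt_zero htK
    refine Filter.Tendsto.cauchySeq (x := (0 : ℝ)) (tendsto_atTop_of_eventually_const (i₀ := K₁) fun K hK => ?_)
    show ⨍ x, W x ∂μ (K + K₀) = 0
    rw [hzero (K + K₀) (le_trans hK (Nat.le_add_right K K₀)), average_zero_measure]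
  · have hz' : ∀ K, K₀ ≤ K → μ K ≠ 0 := fun K hK h0 => hz ⟨K, hK, h0⟩
    refine cauchySeq_of_dist_le_of_summable _ (fun K => ?_) (((summable_nat_add_iff K₀).mpr hr).mul_left 8)
    have e : K + 1 + K₀ = K + K₀ + 1 := Nat.add_right_comm K 1 K₀
    haveI : NeZero (μ (K + K₀)) := ⟨hz' _ (Nat.le_add_left K₀ K)⟩
    haveI : NeZero (μ (K + K₀ + 1)) := ⟨e ▸ hz' _ (Nat.le_add_left K₀ (K + 1))⟩
    show dist (⨍ x, W x ∂μ (K + K₀)) (⨍ x, W x ∂μ (K + 1 + K₀)) ≤ 8 * r (K + K₀)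
    rw [Real.dist_eq, abs_sub_comm, e, average_eq', average_eq']
    exact abs_integral_normalize_sub_le_of_isTilt (ht (K + K₀) (Nat.le_add_left K₀ K)) hWm hW

/-- **SUFFICIENT CONDITION 2 — SUMMABLE INCREMENTS OF THE NORMALISED LAWS ⇒ CAUCHY AVERAGES** (the total-variation / `L¹` typing:
`|⨍ W dμ_{K+1} − ⨍ W dμ_K| ≤ t_K` for `K ≥ K₀`, `Σ t_K < ∞`; e.g. `t_K` = twice the TV distance of the normalised laws). [folklore] -/
theorem cauchySeq_average_of_summable_increments (μ : ℕ → Measure X) (K₀ : ℕ) {t : ℕ → ℝ} (ht : Summable t)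
    {W : X → ℝ} (h : ∀ K, K₀ ≤ K → |(⨍ x, W x ∂μ (K + 1)) - ⨍ x, W x ∂μ K| ≤ t K) :
    CauchySeq fun K => ⨍ x, W x ∂μ (K + K₀) := by
  refine cauchySeq_of_dist_le_of_summable _ (fun K => ?_) ((summable_nat_add_iff K₀).mpr ht)
  have e : K + 1 + K₀ = K + K₀ + 1 := Nat.add_right_comm K 1 K₀
  show dist (⨍ x, W x ∂μ (K + K₀)) (⨍ x, W x ∂μ (K + 1 + K₀)) ≤ t (K + K₀)
  rw [Real.dist_eq, abs_sub_comm, e]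
  exact h (K + K₀) (Nat.le_add_left K₀ K)

end Abstract

/-! ## §2 One family, every `G`, every measurable `ℰ`, any windows: Cauchy conditional expectations at the unit lattice -/

section OneFamily

variable (F : T3Family) {G : Type*} [GaugeGroup G] [MeasurableSpace G] [HaarData G] [RegularGaugeGroup G]
  (ℰ : LoopAverage G)

/-- **CAUCHY CONDITIONAL UNIT-LAW EXPECTATIONS + `K`-UNIFORM WINDOW MASS ⇒ NEAR-CAUCHY UNIT-LAW EXPECTATIONS** (every `G`, every
measurable `ℰ`, any measurable windows `E_K`, `γ ≥ 0`, steps `K < K₀` excised): Gibbs masses of `E_Kᶜ` `≤ δ` from `K₀` on and Cauchy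
CONDITIONAL expectations `⨍ W d(A_K)_*(Gibbs_K|E_K)` (`A_K = unitShift ∘ avg^K`) of a measurable `|W| ≤ 1` from `K₀` on ⇒ the unit-law
expectations `K ↦ ∫ W d(unitLaw (K+K₀))` are within `2δ` of a Cauchy sequence (oscillation `≤ 4δ`). [cite: King1986, Thm 3.4 (3.9)-(3.13) p.656] -/
theorem exists_cauchySeq_near_integral_unitLaw_of_condCauchy (hE : ℰ.MeasurableE) {γ : ℝ} (hγ : 0 ≤ γ) (K₀ : ℕ)
    (E : ∀ K, Set (GaugeField (F.P K) 0 G)) (hEm : ∀ K, MeasurableSet (E K)) {δ : ℝ}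
    (hmass : ∀ K, K₀ ≤ K → (gibbsK F ℰ γ K).real (E K)ᶜ ≤ δ)
    {W : GaugeField (F.P 0) 0 G → ℝ} (hWm : Measurable W) (hW : ∀ u, |W u| ≤ 1)
    (hC : CauchySeq fun K => ⨍ u, W u
      ∂Measure.map (unitA F ℰ (K + K₀)) ((gibbsK F ℰ γ (K + K₀)).restrict (E (K + K₀)))) :
    ∃ b : ℕ → ℝ, CauchySeq b ∧ ∀ K, |(∫ u, W u ∂F.unitLaw ℰ hE γ (K + K₀)) - b K| ≤ 2 * δ :=
  exists_cauchySeq_near_integral_of_cauchySeq_average (fun K => F.unitLaw ℰ hE γ K)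
    (fun K => Measure.map (unitA F ℰ K) ((gibbsK F ℰ γ K).restrict (E K)))
    (fun K => Measure.map (unitA F ℰ K) ((gibbsK F ℰ γ K).restrict (E K)ᶜ)) K₀
    (fun K => isProbabilityMeasure_unitLaw hE hγ K) (fun K _ => unitLaw_eq_map_restrict_add hE K (hEm K))
    (fun K hK => by rw [real_map_restrict_univ hE]; exact hmass K hK) hWm hW hC

end OneFamily

/-! ## §3 THE PATTERN: Cauchy conditional expectations at every refinement depth + a `K`-uniform mass vanishing along
refinement ⇒ the continuum limit -/

section Pattern

variable (F : T3Family) {G : Type*} [GaugeGroup G] [MeasurableSpace G] [HaarData G] [RegularGaugeGroup G]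
  (ℰ : LoopAverage G)

/-- **THE WIDENING AT ITS LOGICAL MINIMUM — LOOP PRODUCTS ONLY, `∀ ε ∃ depth` FORM** (every `G`, every measurable `ℰ`, `γ ≥ 0`):
if for every `ε > 0` there are a depth `n`, an excision depth `K₀`, a mass `δ ≤ ε` and measurable windows `E_K` of `F.refine n` at
`γL^{-n}` with (i) Gibbs masses of `E_Kᶜ` `≤ δ` from `K₀` on and (ii) for every label string `Cs` of the ORIGINAL family Cauchy
conditional expectations of `coarseObs Cs` given `E_K` from `K₀` on, then `HasContinuumLimit (F.scheme ℰ γ)` (`expectAt_refine`; §2;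
the landed `cauchySeq_of_forall_near_cauchySeq`). [cite: King1986, Thm 3.4 (3.9)-(3.13) p.656] -/
theorem hasContinuumLimit_of_refine_loopCondCauchy_uniformMass (hE : ℰ.MeasurableE) {γ : ℝ} (hγ : 0 ≤ γ)
    (h : ∀ ε : ℝ, 0 < ε → ∃ (n K₀ : ℕ) (δ : ℝ) (E : ∀ K, Set (GaugeField ((F.refine n).P K) 0 G)),
      δ ≤ ε ∧ (∀ K, MeasurableSet (E K)) ∧
      (∀ K, K₀ ≤ K → (gibbsK (F.refine n) ℰ (γ * ((F.L : ℝ)⁻¹) ^ n) K).real (E K)ᶜ ≤ δ) ∧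
      (∀ Cs : List (ULoop3 F), CauchySeq fun K => ⨍ u, coarseObs F n ℰ Cs u
        ∂Measure.map (unitA (F.refine n) ℰ (K + K₀))
          ((gibbsK (F.refine n) ℰ (γ * ((F.L : ℝ)⁻¹) ^ n) (K + K₀)).restrict (E (K + K₀))))) :
    HasContinuumLimit (F.scheme ℰ γ) := by
  intro Cs
  suffices hcs : CauchySeq fun K => (F.scheme ℰ γ).expectAt K Cs from cauchySeq_tendsto_of_complete hcs
  refine cauchySeq_of_forall_near_cauchySeq fun ε hε => ?_
  obtain ⟨n, K₀, δ, E, hδε, hEm, hmass, hC⟩ := h (ε / 2) (half_pos hε)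
  have hγ' : 0 ≤ γ * ((F.L : ℝ)⁻¹) ^ n := mul_nonneg hγ (pow_nonneg (inv_nonneg.mpr (Nat.cast_nonneg _)) n)
  obtain ⟨b, hb, hnear⟩ := exists_cauchySeq_near_integral_unitLaw_of_condCauchy (F.refine n) ℰ hE hγ' K₀ E hEm
    hmass (measurable_coarseObs F n ℰ hE Cs) (abs_coarseObs_le_one F n ℰ Cs) (hC Cs)
  refine ⟨K₀ + n, b, hb, fun K => ?_⟩
  show |(F.scheme ℰ γ).expectAt (K + (K₀ + n)) Cs - b K| ≤ ε
  rw [← Nat.add_assoc, expectAt_refine F n ℰ hE hγ (K + K₀) Cs]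
  exact (hnear K).trans (by linarith)

/-- **THE PATTERN, ALL BOUNDED MEASURABLE OBSERVABLES, `δ n → 0` FORM** (the route's quantifier shape; every `G`, `ℰ`, `γ ≥ 0`): at
every depth `n ≥ n₀` windows `E_K` and an excision depth `K₀(n)` with Gibbs masses of `E_Kᶜ` `≤ δ n` and Cauchy conditional
expectations given `E_K` of EVERY measurable `|W| ≤ 1` on the refined unit torus («the conditional unit laws given the windows converge
setwise»), both from `K₀` on; `δ n → 0` ⇒ `HasContinuumLimit (F.scheme ℰ γ)`. [cite: King1986, Thm 3.4 (3.9)-(3.13) p.656] -/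
theorem hasContinuumLimit_of_refine_condCauchy_uniformMass_tendsto (hE : ℰ.MeasurableE) {γ : ℝ} (hγ : 0 ≤ γ) (n₀ : ℕ)
    {δ : ℕ → ℝ} (hδ : Tendsto δ atTop (𝓝 0))
    (h : ∀ n : ℕ, n₀ ≤ n → ∃ (K₀ : ℕ) (E : ∀ K, Set (GaugeField ((F.refine n).P K) 0 G)),
      (∀ K, MeasurableSet (E K)) ∧
      (∀ K, K₀ ≤ K → (gibbsK (F.refine n) ℰ (γ * ((F.L : ℝ)⁻¹) ^ n) K).real (E K)ᶜ ≤ δ n) ∧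
      (∀ W : GaugeField ((F.refine n).P 0) 0 G → ℝ, Measurable W → (∀ u, |W u| ≤ 1) →
        CauchySeq fun K => ⨍ u, W u ∂Measure.map (unitA (F.refine n) ℰ (K + K₀))
          ((gibbsK (F.refine n) ℰ (γ * ((F.L : ℝ)⁻¹) ^ n) (K + K₀)).restrict (E (K + K₀))))) :
    HasContinuumLimit (F.scheme ℰ γ) := by
  refine hasContinuumLimit_of_refine_loopCondCauchy_uniformMass F ℰ hE hγ fun ε hε => ?_
  obtain ⟨n, hn₀, hn⟩ : ∃ n, n₀ ≤ n ∧ δ n < ε := by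
    obtain ⟨n, hn⟩ := ((hδ.eventually (gt_mem_nhds hε)).and (eventually_ge_atTop n₀)).exists
    exact ⟨n, hn.2, hn.1⟩
  obtain ⟨K₀, E, hEm, hmass, hC⟩ := h n hn₀
  exact ⟨n, K₀, δ n, E, hn.le, hEm, hmass, fun Cs =>
    hC _ (measurable_coarseObs F n ℰ hE Cs) (abs_coarseObs_le_one F n ℰ Cs)⟩

end Pattern

section PatternSU

variable {N : ℕ} [NeZero N] (F : T3Family) (ℰ : LoopAverage (Matrix.specialUnitaryGroup (Fin N) ℂ))

/-- **ON `SU(N)`: THE MINIMAL PATTERN GIVES ALL FOUR CONJUNCTS** of `ContinuumYM3Torus F ℰ γ` (existence from §3; the other three are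
tree theorems, `continuumYM3Torus_iff_hasContinuumLimit_SU`), every measurable `ℰ`, `γ ≥ 0`. [cite: JaffeWittenClay2006, §6.5 p.11] -/
theorem continuumYM3Torus_of_refine_condCauchy_uniformMass (hE : ℰ.MeasurableE) {γ : ℝ} (hγ : 0 ≤ γ) (n₀ : ℕ)
    {δ : ℕ → ℝ} (hδ : Tendsto δ atTop (𝓝 0))
    (h : ∀ n : ℕ, n₀ ≤ n → ∃ (K₀ : ℕ)
      (E : ∀ K, Set (GaugeField ((F.refine n).P K) 0 (Matrix.specialUnitaryGroup (Fin N) ℂ))),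
      (∀ K, MeasurableSet (E K)) ∧
      (∀ K, K₀ ≤ K → (gibbsK (F.refine n) ℰ (γ * ((F.L : ℝ)⁻¹) ^ n) K).real (E K)ᶜ ≤ δ n) ∧
      (∀ W : GaugeField ((F.refine n).P 0) 0 (Matrix.specialUnitaryGroup (Fin N) ℂ) → ℝ, Measurable W →
        (∀ u, |W u| ≤ 1) →
        CauchySeq fun K => ⨍ u, W u ∂Measure.map (unitA (F.refine n) ℰ (K + K₀))
          ((gibbsK (F.refine n) ℰ (γ * ((F.L : ℝ)⁻¹) ^ n) (K + K₀)).restrict (E (K + K₀))))) :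
    ContinuumYM3Torus F ℰ γ :=
  (continuumYM3Torus_iff_hasContinuumLimit_SU F ℰ hE hγ).mpr
    (hasContinuumLimit_of_refine_condCauchy_uniformMass_tendsto F ℰ hE hγ n₀ hδ h)

end PatternSU

/-! ## §4 Leaf level on `SU(2)`/`ℰp`: r2 re-read as Cauchy conditional expectations given all-heights UV-small history -/

section Leaf

/-- **THE RUNG-R3 LEAF FROM r3 AS FILED AND «CAUCHY CONDITIONAL EXPECTATIONS GIVEN ALL-HEIGHTS UV-SMALL HISTORY»** — r2
(`AllHeightsSmallTilt`) with its conclusion `UnitTiltAt F γ b₀ p₀ 0` (sup-norm tilts of summable radii) REPLACED by: for every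
measurable unit-field observable `|W| ≤ 1` the conditional expectations `K ↦ ⨍ W d(A_K)_*(Gibbs_K | histGood … K 0)` form a Cauchy
sequence (same quantifier prefix).  Proof = the route's deciding theorem with §3 for the landed widening (`γ₁ := 1`; r3 at `L = F.L`;
depth `n₀` with `γL^{-n} ≤ min γ₁' γ₂`; windows `histGood (F.refine n) … K 0`, `K₀ = 0`).  CONDITIONAL on both hypotheses (r3 OPEN; the
Cauchy hypothesis is implied by the OPEN r2, §5); no summit, no mass gap. [cite: King1986, Thm 3.4 (3.9)-(3.13) p.656] -/
theorem ym3TorusSU2_of_smallFieldCauchy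
    (hS : ∀ (L : ℕ) (b₀ p₀ : ℝ), 0 < b₀ → 2 < p₀ → ∃ γ₁ : ℝ, 0 < γ₁ ∧ ∀ (F : T3Family) (γ : ℝ), F.L = L → 0 < γ →
      γ ≤ γ₁ → ∀ W : GaugeField (F.P 0) 0 (Matrix.specialUnitaryGroup (Fin 2) ℂ) → ℝ, Measurable W →
        (∀ u, |W u| ≤ 1) → CauchySeq fun K => ⨍ u, W u
          ∂Measure.map (unitA F ℰp K) ((gibbsK F ℰp γ K).restrict (histGood F ℰp (θBal F.L γ b₀ p₀) K 0)))
    (hM : Summit.QuantumFields.YangMills.Theses.SmallFieldWidening.LargeFieldMassRefinementTail) :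
    Literature.MathematicalPhysics.QuantumFieldTheory.Balaban1983to89.T3YM3TorusStatement.YM3TorusSU2 := by
  refine ⟨1, one_pos, fun F γ hγ _ => ?_⟩
  obtain ⟨b₀, p₀, γ₁, hb₀, hp₀, hγ₁, hM'⟩ := hM F.L
  obtain ⟨γ₂, hγ₂, hS'⟩ := hS F.L b₀ p₀ hb₀ hp₀
  obtain ⟨δ, hδ, hmass⟩ := hM' F γ rfl hγ
  obtain ⟨n₀, hle⟩ := exists_depth_le F hγ (lt_min hγ₁ hγ₂)
  refine continuumYM3Torus_of_refine_condCauchy_uniformMass F ℰp measurableE_ℰp hγ.le n₀ hδ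
    fun n hn => ⟨0, fun K => histGood (F.refine n) ℰp (θBal (F.refine n).L (γ * ((F.L : ℝ)⁻¹) ^ n) b₀ p₀) K 0,
      fun K => measurableSet_histGood (F.refine n) ℰp measurableE_ℰp _ K 0,
      fun K _ => hmass n K ((hle n hn).trans (min_le_left _ _)), fun W hWm hW => ?_⟩
  simpa only [Nat.add_zero] using hS' (F.refine n) _ rfl (refine_coupling_pos F hγ n)
    ((hle n hn).trans (min_le_right _ _)) W hWm hW

/-- **THE GENERAL LEAF-LEVEL FORM — ANY WINDOWS CONTAINING THE ALL-HEIGHTS WINDOW, PROFILES BEYOND THRESHOLDS, INITIAL STEPS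
EXCISED** (the quantifier shape of gen 6's `ym3TorusSU2_of_windowTilt` with «chained tilts of summable radii» replaced by «Cauchy
conditional expectations given `E_K` of every measurable `|W| ≤ 1` from `K₀` on») + r3 AS FILED ⇒ the leaf `YM3TorusSU2` (r3's profile
pushed beyond the thresholds by `largeFieldMassRefinementTail_beyond`; `E_Kᶜ ⊆ (histGood … K 0)ᶜ` inherits r3's mass bound).
CONDITIONAL; no summit, no mass gap. [cite: King1986, Thm 3.4 (3.9)-(3.13) p.656] -/
theorem ym3TorusSU2_of_windowCondCauchy
    (hS : ∀ (L : ℕ), ∃ b₁ p₁ : ℝ, ∀ (b₀ p₀ : ℝ), b₁ ≤ b₀ → p₁ ≤ p₀ → 0 < b₀ → 2 < p₀ →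
      ∃ γ₂ : ℝ, 0 < γ₂ ∧ ∀ (F : T3Family) (γ : ℝ), F.L = L → 0 < γ → γ ≤ γ₂ →
        ∃ (K₀ : ℕ) (E : ∀ K, Set (GaugeField (F.P K) 0 (Matrix.specialUnitaryGroup (Fin 2) ℂ))),
          (∀ K, MeasurableSet (E K)) ∧
          (∀ K, K₀ ≤ K → histGood F ℰp (θBal F.L γ b₀ p₀) K 0 ⊆ E K) ∧
          (∀ W : GaugeField (F.P 0) 0 (Matrix.specialUnitaryGroup (Fin 2) ℂ) → ℝ, Measurable W →
            (∀ u, |W u| ≤ 1) → CauchySeq fun K => ⨍ u, W u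
              ∂Measure.map (unitA F ℰp (K + K₀)) ((gibbsK F ℰp γ (K + K₀)).restrict (E (K + K₀)))))
    (hM : Summit.QuantumFields.YangMills.Theses.SmallFieldWidening.LargeFieldMassRefinementTail) :
    Literature.MathematicalPhysics.QuantumFieldTheory.Balaban1983to89.T3YM3TorusStatement.YM3TorusSU2 := by
  refine ⟨1, one_pos, fun F γ hγ _ => ?_⟩
  obtain ⟨b₁, p₁, hS'⟩ := hS F.L
  obtain ⟨b₀, p₀, γ₁, hb₁, hp₁, hb₀, hp₀, hγ₁, -, hM'⟩ := largeFieldMassRefinementTail_beyond hM F.L b₁ p₁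
  obtain ⟨γ₂, hγ₂, hS''⟩ := hS' b₀ p₀ hb₁ hp₁ hb₀ hp₀
  obtain ⟨δ, hδ, hmass⟩ := hM' F γ rfl hγ
  obtain ⟨n₀, hle⟩ := exists_depth_le F hγ (lt_min hγ₁ hγ₂)
  refine continuumYM3Torus_of_refine_condCauchy_uniformMass F ℰp measurableE_ℰp hγ.le n₀ hδ fun n hn => ?_
  obtain ⟨K₀, E, hEm, hsub, hC⟩ :=
    hS'' (F.refine n) _ rfl (refine_coupling_pos F hγ n) ((hle n hn).trans (min_le_right _ _))
  refine ⟨K₀, E, hEm, fun K hK => ?_, hC⟩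
  haveI := isProbabilityMeasure_gibbsK (F.refine n) ℰp (refine_coupling_pos F hγ n).le K
  exact (measureReal_mono (Set.compl_subset_compl.mpr (hsub K hK)) (measure_ne_top _ _)).trans
    (hmass n K ((hle n hn).trans (min_le_left _ _)))

end Leaf

/-! ## §5 Certificates of strength: the filed r2 and its total-variation typing both imply the Cauchy hypothesis -/

section Strength

/-- **KING'S SHAPE IMPLIES THE CAUCHY HYPOTHESIS**: the all-heights unit tilt `UnitTiltAt F γ b₀ p₀ 0` (`γ ≥ 0`) makes the conditional
expectations given all-heights UV-small history of every measurable `|W| ≤ 1` Cauchy (§1, condition 1; `K / 0 = 0`). [cite: King1986, Thm 3.4 (3.9)-(3.10) p.656] -/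
theorem smallFieldCauchy_of_unitTiltAt_zero (F : T3Family) {γ b₀ p₀ : ℝ} (hγ : 0 ≤ γ) (h : UnitTiltAt F γ b₀ p₀ 0)
    {W : GaugeField (F.P 0) 0 (Matrix.specialUnitaryGroup (Fin 2) ℂ) → ℝ} (hWm : Measurable W) (hW : ∀ u, |W u| ≤ 1) :
    CauchySeq fun K => ⨍ u, W u
      ∂Measure.map (unitA F ℰp K) ((gibbsK F ℰp γ K).restrict (histGood F ℰp (θBal F.L γ b₀ p₀) K 0)) := by
  obtain ⟨r, hr, ht⟩ := h
  haveI : ∀ K, IsFiniteMeasure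
      (Measure.map (unitA F ℰp K) ((gibbsK F ℰp γ K).restrict (histGood F ℰp (θBal F.L γ b₀ p₀) K 0))) := fun K => by
    haveI := isProbabilityMeasure_gibbsK F ℰp hγ K
    infer_instance
  simpa only [Nat.add_zero] using cauchySeq_average_of_isTilt
    (fun K => Measure.map (unitA F ℰp K) ((gibbsK F ℰp γ K).restrict (histGood F ℰp (θBal F.L γ b₀ p₀) K 0)))
    0 hr (fun K _ => by simpa only [Nat.div_zero] using ht K) hWm hW

/-- **THE FILED CRUX r2 IMPLIES THE HYPOTHESIS OF `ym3TorusSU2_of_smallFieldCauchy`** (same quantifier prefix; `smallFieldCauchy_of_unitTiltAt_zero`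
under it).  So the Cauchy re-reading is WEAKER than (implied by) `AllHeightsSmallTilt`. [cite: King1986, Thm 3.4 (3.9)-(3.10) p.656] -/
theorem smallFieldCauchy_of_allHeightsSmallTilt
    (hT : Summit.QuantumFields.YangMills.Theses.SmallFieldWidening.AllHeightsSmallTilt) :
    ∀ (L : ℕ) (b₀ p₀ : ℝ), 0 < b₀ → 2 < p₀ → ∃ γ₁ : ℝ, 0 < γ₁ ∧ ∀ (F : T3Family) (γ : ℝ), F.L = L → 0 < γ →
      γ ≤ γ₁ → ∀ W : GaugeField (F.P 0) 0 (Matrix.specialUnitaryGroup (Fin 2) ℂ) → ℝ, Measurable W →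
        (∀ u, |W u| ≤ 1) → CauchySeq fun K => ⨍ u, W u
          ∂Measure.map (unitA F ℰp K) ((gibbsK F ℰp γ K).restrict (histGood F ℰp (θBal F.L γ b₀ p₀) K 0)) := by
  intro L b₀ p₀ hb₀ hp₀
  obtain ⟨γ₁, hγ₁, hT'⟩ := hT L b₀ p₀ hb₀ hp₀
  exact ⟨γ₁, hγ₁, fun F γ hFL hγ hγγ₁ W hWm hW =>
    smallFieldCauchy_of_unitTiltAt_zero F hγ.le (hT' F γ hFL hγ hγγ₁) hWm hW⟩

/-- **THE ROUTE'S IMPLICATION r2 → r3 → LEAF FACTORS THROUGH §4** (certificate that the Cauchy hypothesis sits between the filed r2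
and what the assembly needs; the route's `closes`/`Assembly` are untouched).  CONDITIONAL on both cruxes (open); no summit. [cite: King1986, Thm 3.4 (3.9)-(3.13) p.656] -/
theorem ym3TorusSU2_of_cruxes_via_smallFieldCauchy
    (hT : Summit.QuantumFields.YangMills.Theses.SmallFieldWidening.AllHeightsSmallTilt)
    (hM : Summit.QuantumFields.YangMills.Theses.SmallFieldWidening.LargeFieldMassRefinementTail) :
    Literature.MathematicalPhysics.QuantumFieldTheory.Balaban1983to89.T3YM3TorusStatement.YM3TorusSU2 :=
  ym3TorusSU2_of_smallFieldCauchy (smallFieldCauchy_of_allHeightsSmallTilt hT) hM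

/-- **THE TOTAL-VARIATION TYPING OF r2 IMPLIES THE CAUCHY HYPOTHESIS**: SUMMABLE INCREMENTS `|⨍ W dμ̃_{K+1} − ⨍ W dμ̃_K| ≤ t_K`,
`Σ t_K < ∞`, of the conditional unit laws given all-heights UV-small history (an `L¹`/TV comparison of consecutive constrained unit
laws, no sup-norm log-density) ⇒ Cauchy conditional expectations (§1, condition 2). [folklore] -/
theorem smallFieldCauchy_of_summable_condIncrements (F : T3Family) {γ b₀ p₀ : ℝ} {t : ℕ → ℝ} (ht : Summable t)
    (h : ∀ (K : ℕ) (W : GaugeField (F.P 0) 0 (Matrix.specialUnitaryGroup (Fin 2) ℂ) → ℝ), Measurable W →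
      (∀ u, |W u| ≤ 1) →
      |(⨍ u, W u ∂Measure.map (unitA F ℰp (K + 1))
          ((gibbsK F ℰp γ (K + 1)).restrict (histGood F ℰp (θBal F.L γ b₀ p₀) (K + 1) 0))) -
        ⨍ u, W u ∂Measure.map (unitA F ℰp K)
          ((gibbsK F ℰp γ K).restrict (histGood F ℰp (θBal F.L γ b₀ p₀) K 0))| ≤ t K)
    {W : GaugeField (F.P 0) 0 (Matrix.specialUnitaryGroup (Fin 2) ℂ) → ℝ} (hWm : Measurable W) (hW : ∀ u, |W u| ≤ 1) :
    CauchySeq fun K => ⨍ u, W u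
      ∂Measure.map (unitA F ℰp K) ((gibbsK F ℰp γ K).restrict (histGood F ℰp (θBal F.L γ b₀ p₀) K 0)) := by
  simpa only [Nat.add_zero] using cauchySeq_average_of_summable_increments
    (fun K => Measure.map (unitA F ℰp K) ((gibbsK F ℰp γ K).restrict (histGood F ℰp (θBal F.L γ b₀ p₀) K 0)))
    0 ht (W := W) (fun K _ => h K W hWm hW)

/-- **THE RUNG-R3 LEAF FROM r3 AS FILED AND THE TOTAL-VARIATION TYPING OF r2**: r2's quantifier prefix with the conclusion «the
conditional unit laws given all-heights UV-small history have summable increments uniformly over measurable `|W| ≤ 1`» (an `L¹`/TV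
comparison — NO sup-norm log-density, NO uniformity over torus zero-modes beyond what an integral sees) + `LargeFieldMassRefinementTail`
⇒ `YM3TorusSU2`.  CONDITIONAL; no summit, no mass gap. [cite: King1986, Thm 3.4 (3.9)-(3.13) p.656] -/
theorem ym3TorusSU2_of_summableCondIncrements
    (hV : ∀ (L : ℕ) (b₀ p₀ : ℝ), 0 < b₀ → 2 < p₀ → ∃ γ₁ : ℝ, 0 < γ₁ ∧ ∀ (F : T3Family) (γ : ℝ), F.L = L → 0 < γ →
      γ ≤ γ₁ → ∃ t : ℕ → ℝ, Summable t ∧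
        ∀ (K : ℕ) (W : GaugeField (F.P 0) 0 (Matrix.specialUnitaryGroup (Fin 2) ℂ) → ℝ), Measurable W →
          (∀ u, |W u| ≤ 1) →
          |(⨍ u, W u ∂Measure.map (unitA F ℰp (K + 1))
              ((gibbsK F ℰp γ (K + 1)).restrict (histGood F ℰp (θBal F.L γ b₀ p₀) (K + 1) 0))) -
            ⨍ u, W u ∂Measure.map (unitA F ℰp K)
              ((gibbsK F ℰp γ K).restrict (histGood F ℰp (θBal F.L γ b₀ p₀) K 0))| ≤ t K)
    (hM : Summit.QuantumFields.YangMills.Theses.SmallFieldWidening.LargeFieldMassRefinementTail) :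
    Literature.MathematicalPhysics.QuantumFieldTheory.Balaban1983to89.T3YM3TorusStatement.YM3TorusSU2 := by
  refine ym3TorusSU2_of_smallFieldCauchy (fun L b₀ p₀ hb₀ hp₀ => ?_) hM
  obtain ⟨γ₁, hγ₁, hV'⟩ := hV L b₀ p₀ hb₀ hp₀
  refine ⟨γ₁, hγ₁, fun F γ hFL hγ hγγ₁ W hWm hW => ?_⟩
  obtain ⟨t, ht, h⟩ := hV' F γ hFL hγ hγγ₁
  exact smallFieldCauchy_of_summable_condIncrements F ht h hWm hW

end Strength

end Summit.QuantumFields.YangMills.Theorems.WideningSmallFieldCauchy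

end
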